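import Summits.QuantumFields.YangMills.Theorems.BalabanUVNodesN27AtRecord11
import Summits.QuantumFields.YangMills.Theorems.BalabanUVNodesN27KeyedKnitWorldFree
import Literature.MathematicalPhysics.QuantumFieldTheory.Balaban1983to89.Node00.Record13DatumKeyCo

/-!
# BalabanUVNodes ∕ N27 = binder B5 AT THE RECORD, XXXVIᶜᵒ — N27 AT NODE 00's RE-BASED CORE-KEYED STAGE-13 RECORD `Node00.IsRecordOfRecord₁₃CCo` (`Node00/Record13Co.lean`): THE Co EDITION OF
# MODULE XXXVI `…N27AtRecord13` (p494380 ‴ ∕ p504053 ⁗) — the ₅C shadow ∕ tower roads, the XXIV∕XXIVb keyed-knit instance at the key `(Stage13Params, Provisos₁₃Core, Admissible, datumOfRecord₁₃Co)`,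
# honesty, the K3 shapes, the guarded BC3 composer, N27 at RR-2's Co regime ∕ CN record classes `IsRecordOfRecord₁₃CCoOn Rg` ∕ `…CCoN` (`Node00/Record13DatumKeyCo.lean`)
# (cell `pub-ymgap`, HUMAN RULING D-0062 Track A, R134 seat `pub-ymgap-dag-n27-c` (s2) gen 7; `--kind proof --supports <K3 id of record> --as helper`; COUNT-NEUTRAL; `N`-generic, NO Theses import)

WHY THIS EDITION (director-ym №152 (β): print's background is the minimiser over [6]'s class (1.7) ∧ (1.9), `UbgMSCoOfRecord` (node00-def-R FILE 22 p512668); node00-def-T KEY-RULE-21: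
RECORD 13 re-based on it in `Node00/Record13Co.lean` — `UbgOfRecord₁₃Co`, `towerOfRecord₁₃Co ∕ datumOfRecord₁₃Co` keyed on the UNCHANGED background-free `θ.Provisos₁₃Core F N`, record
`IsRecordOfRecord₁₃CCo` (same clause order as `…C ∕ …CSep`), shadow `shadow₅OfRecord₁₃Co`, faces `…_stage13Co…`; the item editions ‴ `Provisos₁₃` ∕ ⁗ `Provisos₁₃Sep` ∕ `SepMixed` (asides) ∕
⁵ v1.4 `Provisos₁₃SepCo` (`Node00/Record13SepCo.lean`, `datumOfRecord₁₃SepCo θ h := datumOfRecord₁₃Co θ h.toCore`, `rfl`); plan CORE-YES l.17420, dag-n22-e DESIGN-INPUT-CORE l.17415, RR-2 CORE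
l.17476, dag-lead DEDUP-265∕266 one-declarer-by-lineage).  This module is bg-BLIND and proviso-FIELD-blind: the provisos enter ONLY as the binder type `hc : θ.Provisos₁₃Core F N` and inside
`datumOfRecord₁₃Co F N θ hc`, so it is keyed ONCE — a consumer at any item edition's tuple `(θ, h : θ.Provisos₁₃SepCo F N)` applies it at `hc := h.toCore`, datum by `rfl`; only the
item-facing composer leaf (module XXXVII-class) is re-typed per edition.  Statements AND proofs = the ‴ module's, token for token under KEY-RULE-21 (R1 `₁₃C ↦ ₁₃CCo`, R2 `…₁₃ ↦ …₁₃Co`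
on the datum ∕ tower ∕ shadow tokens, R3 `_stage13 ↦ _stage13Co`, provisos `Provisos₁₃ ↦ Provisos₁₃Core`) + RR-2's AFTER-C key names + the carriers' stems; my stems `…rec13C… ↦ …rec13CCo…`,
`keyed₁₃ ↦ keyed₁₃Co`, `homes₁₃ ↦ homes₁₃Co`, `…₁₃On ↦ …₁₃CoOn`.

WHAT IS KERNEL-CHECKED ([bookkeeping]; 0 `def`, 0 `sorry`; every stub ∕ reading ∕ edge a HYPOTHESIS or PARAMETER — 0∕1 at every record today).
* §1 ROADS FROM ₅C (def-T's ₁₃ shadow faces BY NAME): `b5_of_isRecordOfRecord₁₃CCo` · `spine_rec13CCo_of_spine_rec5C` (`Spine ₅C → Spine ₁₃CCo`, XVI `spine_of_shadow` at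
  `Node00.exists_isRecordOfRecord₅C_of_isRecordOfRecord₁₃CCo`) · `b5_datumOfRecord₁₃Co_of_spine₅C` · `towerBound_of_isRecordOfRecord₁₃CCo` (the datum IS the tower datum of the shadow's machine,
  `toCore_machineOfRecord₅_shadow₁₃Co` `rfl`) · `spine_rec13CCo_of_coarser` (XVII `spine_of_towerBound`).
* §2 THE XXIV INSTANCE AT THE STAGE-13 KEY `(Θ, Hp, Adm, datumOf) := (Stage13Params, Provisos₁₃Core, Admissible, datumOfRecord₁₃Co)`: (K1) `keyed₁₃Co_of_isRecordOfRecord₁₃CCo` (def-T's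
  `exists_provisos_of_isRecordOfRecord₁₃CCo`), (K2) `exists_world_of_keyed₁₃Co` (window `θ.γ`, `0 < θ.γ` = `Admissible.toStage9.gamma_pos`); `spine_rec13CCo_iff_forall_datumOfRecord₁₃Co` (B5 at ₁₃CCo ⟺
  B5 at every `datumOfRecord₁₃Co F N θ h`, worlds eliminated) · `spine_rec13CCo_of_keyedFaces` (N20 ∕ N21 at a spine reading `cr`, K4's six rates at a rate reading `rr`, the same-tuple N19′ edge,
  the keyed extraction clause — readings off `(θ : Stage13Params F N, h : θ.Provisos₁₃Core F N)`, PARAMETERS) · `spine_rec13CCo_of_rateStubs_twoKeys₁₃Co` (divided home: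
  `SRec`∕`RRec` characterised by `cr`∕`rr`, PAIR-FORM N19′ edge).
* §3 HONESTY AT STAGE 13: `flow_g_zero_datumOfRecord₁₃Co` (the bare coupling of the run `P` IS `P.g0`) · `not_levelZeroNegative_datumOfRecord₁₃Co` — XXIII's Stage-11 vacuity road (ii) is
  CLOSED at Stage 13 too (`Node00.sect2Form_zero_datumOfRecord₁₃Co` at the run `⟨0, 0, 1⟩`): B5 at ₁₃CCo has content exactly where (B) and END hold; inhabitation is K0 `Record13Inhabited`
  (stmt-QuantumFields-19909, open).
* §4 `k3Shape_iff_spine_rec13CCo` (K3's `(D, w)` text over ₁₃CCo ⟺ `Spine ₁₃CCo`) · `keyedGuarded₁₃Co_of_spine_rec13CCo` (B5 at every admissible Stage-13 datum under ANY guard `G θ` from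
  `Spine ₁₃CCo`, a fortiori — at `N = 2`, `G := ZtUnity ∧ SlotsNondegenerate₁₃`, K3 up to its displayed antecedents).
* §5 `keyedGuarded₁₃Co_of_keyedFaces` — THE GUARDED BC3 COMPOSER, `N`- and guard-generic (XXIVb `forall_guarded_of_keyedFaces` at the Stage-13 key): the five keyed faces asked ONLY of
  admissible tuples with provisos satisfying `G θ` ⇒ B5 at every such tuple's datum.
* §6 N27 AT THE REGIME ∕ CN RECORD CLASSES (RR-2 §§4–7): `spine_rec13CCoOn_iff_forall_guarded` (B5 at `IsRecordOfRecord₁₃CCoOn Rg` ⟺ «∀ θ hP, Rg F θ → θ.Admissible F N → B5 at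
  `datumOfRecord₁₃Co F N θ hP`», `forall_isRecordOfRecord₁₃CCoOn_iff`) · `spine_rec13CCoOn_of_spine_rec13CCo` · `spine_rec13CCoOn_anti` · `spine_rec13CCoOn_true_iff` · `spine_rec13CCoN_iff_forall_guarded`
  (at the guard of record `Node00.unityNondeg₁₃ N` the right-hand side is K3's θ-sentence up to its antecedents) · `s_N27x_rec13CCoOn_of_keyed` · `spine_rec13CCoOn_of_keyedFaces` (the
  guarded BC3 composer concluding `Spine` AT THE REGIME CLASS — every record-level road run at `Rec := IsRecordOfRecord₁₃CCoN F 2` concludes K3 EXACTLY, module XXXVII-class leaf).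

HONEST FRAMING.  COMPOSITE-node bookkeeping: nothing of Bałaban's is asserted or instantiated; every K4 ∕ K5 estimate is a HYPOTHESIS (producers = N14–N22 ∕ N27x at the ₁₃ homes,
re-keying in progress); NE7 ∕ NE7b ∕ NE7c NOT PRINTED for d = 4 and NOT PROVED; NO node discharged; K3 NOT claimed; no ₁₃ inhabitant claimed (K0 open); counts UNMOVED (typed 28∕28 ·
discharged 5∕27, A 5∕28); one finite four-torus programme at fixed `ε` — NOT ℝ⁴, NOT infinite volume, NOT OS, NOT a mass gap, NOT Clay.  No decl below carries a cite tag.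
-/

namespace Summit.QuantumFields.YangMills.Theorems.BalabanUVNodesN27SpineRecord

open Literature.MathematicalPhysics.QuantumFieldTheory.Balaban1983to89
open Literature.MathematicalPhysics.QuantumFieldTheory.Balaban1983to89.T4Continuum
open Literature.MathematicalPhysics.QuantumFieldTheory.Balaban1983to89.T4DatumAssembly
open T4WeightBudget (RelWeightBound)
open T4IndicatorShell (ShellWeightBound)
open T4ContinuumYM4Torus (ForSmallCouplings)
open Summit.QuantumFields.BalabanUV.T4Continuum.Spine
open YMDAG.UVSplit
open Node00 (Stage13Params datumOfRecord₁₃Co IsRecordOfRecord₁₃CCo IsDatumOfRecord₁₃CCo)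

variable {N : ℕ} [NeZero N]

/-! ## §1 The ₅C roads at Stage 13 -/

section Roads

/-- **B5 AT ONE STAGE-13 RECORD PAIR from `Spine ₅C`**: the world of a ₁₃CCo record is a ₅C record at the shadow datum with the same `C` and `av`
(`Node00.exists_isRecordOfRecord₅C_of_isRecordOfRecord₁₃CCo`); B5 reads nothing else (XVI `b5_congr`). [bookkeeping] -/
theorem b5_of_isRecordOfRecord₁₃CCo (h₅ : Spine (N := N) fun F D w => Node00.IsRecordOfRecord₅C F N D w)
    {F : T4Family} {D : Datum F N} {w : DagBinding.WorldP} (h : IsRecordOfRecord₁₃CCo F N D w) :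
    T4ApexHybrid.HybridNE7Under D (DagBinding.EndpointExistence D.C.toB12) := by
  obtain ⟨D₅, h5, hC, -, -, hav⟩ := Node00.exists_isRecordOfRecord₅C_of_isRecordOfRecord₁₃CCo h
  exact (b5_congr hC hav).mp (h₅ F D₅ w h5)

/-- **THE ₁₃CCo CLOSER OF THE COMPOSITE NODE, SHADOW ROAD**: `Spine ₅C → Spine ₁₃CCo` (XVI `spine_of_shadow`). [bookkeeping] -/
theorem spine_rec13CCo_of_spine_rec5C (h₅ : Spine (N := N) fun F D w => Node00.IsRecordOfRecord₅C F N D w) :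
    Spine (N := N) fun F D w => IsRecordOfRecord₁₃CCo F N D w :=
  spine_of_shadow (Rec' := fun F D w => Node00.IsRecordOfRecord₅C F N D w) (fun F D w h => by
    obtain ⟨D₅, h5, hC, -, -, hav⟩ := Node00.exists_isRecordOfRecord₅C_of_isRecordOfRecord₁₃CCo h
    exact ⟨D₅, h5, hC, hav⟩) h₅

/-- **B5 AT EVERY STAGE-13 DATUM OF RECORD from `Spine ₅C`** (the datum is a ₁₃CCo record at some world: `Node00.exists_world_isRecordOfRecord₁₃CCo`, window `θ.γ`).
[bookkeeping] -/
theorem b5_datumOfRecord₁₃Co_of_spine₅C (h₅ : Spine (N := N) fun F D w => Node00.IsRecordOfRecord₅C F N D w)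
    (F : T4Family) (θ : Stage13Params F N) (h : θ.Provisos₁₃Core F N) (hθ : θ.Admissible F N) :
    T4ApexHybrid.HybridNE7Under (datumOfRecord₁₃Co F N θ h) (DagBinding.EndpointExistence (datumOfRecord₁₃Co F N θ h).C.toB12) := by
  obtain ⟨w, hw, -⟩ := Node00.exists_world_isRecordOfRecord₁₃CCo F N θ h hθ (γw := θ.γ) ⟨hθ.toStage9.gamma_pos, le_rfl⟩
  exact b5_of_isRecordOfRecord₁₃CCo h₅ hw

/-- **EVERY ₁₃CCo RECORD PAIR IS TOWER-BOUND** (XVII's shape): the datum IS the tower datum of the machine of the SHADOW Stage-5 parameters `Node00.shadow₅OfRecord₁₃Co F N θ h w.γ`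
and the tower of record `Node00.towerOfRecord₁₃Co F N θ h` (`rfl`, def-T's `toCore_machineOfRecord₅_shadow₁₃Co`), the world bound with the shadow's letters (`upOfRecord₅C_shadow₁₃Co`, `rfl`). [bookkeeping] -/
theorem towerBound_of_isRecordOfRecord₁₃CCo {F : T4Family} {D : Datum F N} {w : DagBinding.WorldP} (h : IsRecordOfRecord₁₃CCo F N D w) :
    ∃ (θ : Node00.Stage5Params F N) (_ : θ.Admissible) (τ : (Node00.machineOfRecord₅ F N θ).toCore.Tower (Node00.avOfRecord F N)),
      (∀ (p : B12.RunParams) (k : ℕ), θ.res.R p k = τ.shadowR p k) ∧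
      D = datumOfTower F N (Node00.machineOfRecord₅ F N θ).toCore τ ∧
      w.C = D.C ∧ w.γ = θ.γ ∧ w.L = (θ.L : ℝ) ∧ (∀ P : B12.RunParams, w.up P = Node00.upOfRecord₅C F N θ P) := by
  obtain ⟨θ, hP, hθ, rfl, hC, ⟨hγ0, -⟩, hL, hup⟩ := h
  exact ⟨Node00.shadow₅OfRecord₁₃Co F N θ hP w.γ, Node00.admissible_shadow₁₃Co F N θ hP hθ hγ0, Node00.towerOfRecord₁₃Co F N θ hP,
    fun _ _ => rfl, rfl, hC, rfl, hL, hup⟩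

/-- **TOWER ROAD**: B5 at ANY record predicate coarser than ₅C gives B5 at ₁₃CCo (XII `spine_antitone`, XVII `spine_of_towerBound`). [bookkeeping] -/
theorem spine_rec13CCo_of_coarser {Rec : RecordPred N}
    (hle : ∀ (F : T4Family) (D : Datum F N) (w : DagBinding.WorldP), Node00.IsRecordOfRecord₅C F N D w → Rec F D w) (h : Spine Rec) :
    Spine (N := N) fun F D w => IsRecordOfRecord₁₃CCo F N D w :=
  spine_of_towerBound N (fun _ _ _ h12 => towerBound_of_isRecordOfRecord₁₃CCo h12) (spine_antitone hle h)

end Roads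

/-! ## §2 The XXIV instance at the Stage-13 key -/

section Keyed

/-- **(K1) AT STAGE 13**: every ₁₃CCo record pair is keyed — an admissible `θ : Stage13Params F N` with provisos realises the datum (def-T's
`exists_provisos_of_isRecordOfRecord₁₃CCo`, restated in XXIV's binder order). [bookkeeping] -/
theorem keyed₁₃Co_of_isRecordOfRecord₁₃CCo (F : T4Family) (D : Datum F N) (w : DagBinding.WorldP) (h : IsRecordOfRecord₁₃CCo F N D w) :
    ∃ (θ : Stage13Params F N) (hP : θ.Provisos₁₃Core F N), θ.Admissible F N ∧ D = datumOfRecord₁₃Co F N θ hP :=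
  Node00.exists_provisos_of_isRecordOfRecord₁₃CCo h

/-- **(K2) AT STAGE 13**: every admissible Stage-13 tuple with provisos is a ₁₃CCo record at its datum for some world (window `θ.γ`; `0 < θ.γ` is Stage-9 admissibility).
[bookkeeping] -/
theorem exists_world_of_keyed₁₃Co (F : T4Family) (θ : Stage13Params F N) (hP : θ.Provisos₁₃Core F N) (hθ : θ.Admissible F N) :
    ∃ w : DagBinding.WorldP, IsRecordOfRecord₁₃CCo F N (datumOfRecord₁₃Co F N θ hP) w := by
  obtain ⟨w, hw, -⟩ := Node00.exists_world_isRecordOfRecord₁₃CCo F N θ hP hθ (γw := θ.γ) ⟨hθ.toStage9.gamma_pos, le_rfl⟩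
  exact ⟨w, hw⟩

/-- **B5 AT ₁₃CCo ⟺ B5 AT EVERY STAGE-13 DATUM OF RECORD** (worlds eliminated; XXIV `spine_iff_forall_keyed` at the Stage-13 key). [bookkeeping] -/
theorem spine_rec13CCo_iff_forall_datumOfRecord₁₃Co :
    Spine (N := N) (fun F D w => IsRecordOfRecord₁₃CCo F N D w) ↔
      ∀ (F : T4Family) (θ : Stage13Params F N) (hP : θ.Provisos₁₃Core F N), θ.Admissible F N →
        T4ApexHybrid.HybridNE7Under (datumOfRecord₁₃Co F N θ hP) (DagBinding.EndpointExistence (datumOfRecord₁₃Co F N θ hP).C.toB12) :=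
  spine_iff_forall_keyed (Θ := fun F => Stage13Params F N) (fun θ => θ.Provisos₁₃Core _ N) (fun θ => θ.Admissible _ N)
    (fun θ h => datumOfRecord₁₃Co _ N θ h) _ keyed₁₃Co_of_isRecordOfRecord₁₃CCo exists_world_of_keyed₁₃Co

variable (cr : (F : T4Family) → (θ : Stage13Params F N) → θ.Provisos₁₃Core F N → (ℕ → ℝ) → List (ULoop F) → SpineCarriers)
  (rr : (F : T4Family) → (θ : Stage13Params F N) → θ.Provisos₁₃Core F N → (ℕ → ℝ) → List (ULoop F) → RateCarriers N)

/-- **N27 = B5 AT THE STAGE-13 RECORD FROM THE CHILDREN'S ESTIMATES READ OFF THE SAME STAGE-13 TUPLE** (XXIV `spine_of_keyedFaces` at the Stage-13 key): N20 `RelWeightBound` and N21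
`ShellWeightBound` at `cr F θ h g₀ os`, K4's six rates jointly at `rr F θ h g₀ os` on `datumOfRecord₁₃Co F N θ h`, the same-tuple N19′ edge, and the keyed extraction clause (positivity +
E1∕E2 under (B), END, small tuned couplings) for EVERY admissible Stage-13 θ with provisos ⇒ `Spine ₁₃CCo`.  Every hypothesis 0∕1; `cr`, `rr` PARAMETERS. [bookkeeping] -/
theorem spine_rec13CCo_of_keyedFaces
    (h20 : ∀ (F : T4Family) (θ : Stage13Params F N) (hP : θ.Provisos₁₃Core F N), θ.Admissible F N → ∀ (g₀ : ℕ → ℝ) (os : List (ULoop F)),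
      RelWeightBound (cr F θ hP g₀ os).l₀ (cr F θ hP g₀ os).T (cr F θ hP g₀ os).A (cr F θ hP g₀ os).B (cr F θ hP g₀ os).Bad (cr F θ hP g₀ os).W)
    (h21 : ∀ (F : T4Family) (θ : Stage13Params F N) (hP : θ.Provisos₁₃Core F N), θ.Admissible F N → ∀ (g₀ : ℕ → ℝ) (os : List (ULoop F)),
      ShellWeightBound (cr F θ hP g₀ os).l₀ (cr F θ hP g₀ os).T (cr F θ hP g₀ os).A (cr F θ hP g₀ os).B (cr F θ hP g₀ os).shA (cr F θ hP g₀ os).shB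
        (cr F θ hP g₀ os).Wsh)
    (hrates : ∀ (F : T4Family) (θ : Stage13Params F N) (hP : θ.Provisos₁₃Core F N), θ.Admissible F N → ∀ (g₀ : ℕ → ℝ) (os : List (ULoop F)),
      RatesAt (datumOfRecord₁₃Co F N θ hP) (rr F θ hP g₀ os))
    (h19 : ∀ (F : T4Family) (θ : Stage13Params F N) (hP : θ.Provisos₁₃Core F N), θ.Admissible F N → ∀ (g₀ : ℕ → ℝ) (os : List (ULoop F)),
      RatesAt (datumOfRecord₁₃Co F N θ hP) (rr F θ hP g₀ os) → letI := (cr F θ hP g₀ os).dec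
        ∃ δ : ℕ → ℝ, NE7.Core (cr F θ hP g₀ os).l₀ (cr F θ hP g₀ os).vol (cr F θ hP g₀ os).T (cr F θ hP g₀ os).Bad
          (fun K t τ => (cr F θ hP g₀ os).A K t τ - (cr F θ hP g₀ os).shA K t τ) (fun K t τ => (cr F θ hP g₀ os).B K t τ - (cr F θ hP g₀ os).shB K t τ) δ ∧
          Summable δ)
    (hx : ∀ (F : T4Family) (θ : Stage13Params F N) (hP : θ.Provisos₁₃Core F N), θ.Admissible F N →
      B16.EndStatementBPrinted (datumOfRecord₁₃Co F N θ hP).C → DagBinding.EndpointExistence (datumOfRecord₁₃Co F N θ hP).C.toB12 →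
        ForSmallCouplings (datumOfRecord₁₃Co F N θ hP) fun g₀ => ∀ os : List (ULoop F),
          0 < (cr F θ hP g₀ os).l₀ ∧ 0 < (cr F θ hP g₀ os).vol ∧
          (∀ (K : ℕ) (t : ℝ), |t| ≤ (cr F θ hP g₀ os).l₀ →
            T4GenFunBounds.schemeZ ((datumOfRecord₁₃Co F N θ hP).scheme g₀) os ((cr F θ hP g₀ os).K₀ + K) t =
              ∑ τ ∈ (cr F θ hP g₀ os).T K, (cr F θ hP g₀ os).A K t τ) ∧
          (∀ (K : ℕ) (t : ℝ), |t| ≤ (cr F θ hP g₀ os).l₀ →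
            T4GenFunBounds.schemeZ ((datumOfRecord₁₃Co F N θ hP).scheme g₀) os ((cr F θ hP g₀ os).K₀ + K + 1) t =
              ∑ τ ∈ (cr F θ hP g₀ os).T K, (cr F θ hP g₀ os).B K t τ)) :
    Spine (N := N) fun F D w => IsRecordOfRecord₁₃CCo F N D w :=
  spine_of_keyedFaces (Θ := fun F => Stage13Params F N) (fun θ => θ.Provisos₁₃Core _ N) (fun θ => θ.Admissible _ N) (fun θ h => datumOfRecord₁₃Co _ N θ h) _
    (fun θ h => cr _ θ h) (fun θ h => rr _ θ h) keyed₁₃Co_of_isRecordOfRecord₁₃CCo h20 h21 hrates h19 hx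

variable (SRec : SpineRecordPred N) (RRec : RateRecordPred N)

/-- **N27 = B5 AT THE STAGE-13 RECORD FROM THE STUB INSTANCES OF A DIVIDED STAGE-13 CARRIER HOME** (XXIV `spine_of_rateStubs_twoKeys` at the Stage-13 key): for ANY `SRec`
characterised by a Stage-13 spine reading `cr` and ANY `RRec` characterised by a Stage-13 rate reading `rr`, the K4 stubs `S_R00x ₁₃CCo RRec` · `S_N14`–`S_N18`, `S_N22` at `RRec`, the K5
stubs `S_N27x ₁₃CCo SRec` · `S_N20` · `S_N21` at `SRec` and the PAIR-FORM N19′ edge give `Spine ₁₃CCo`.  Every stub a HYPOTHESIS (0∕1; the shape dag-n20-d's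
`sRec₁₃Co_iff` and dag-n22-e's `rRec₁₃Co`-faces meet). [bookkeeping] -/
theorem spine_rec13CCo_of_rateStubs_twoKeys₁₃Co
    (hkeyS : ∀ (F : T4Family) (D : Datum F N) (g₀ : ℕ → ℝ) (os : List (ULoop F)) (S : SpineCarriers), SRec F D g₀ os S ↔
      ∃ (θ : Stage13Params F N) (hP : θ.Provisos₁₃Core F N), θ.Admissible F N ∧ D = datumOfRecord₁₃Co F N θ hP ∧ S = cr F θ hP g₀ os)
    (hkeyR : ∀ (F : T4Family) (D : Datum F N) (g₀ : ℕ → ℝ) (os : List (ULoop F)) (R : RateCarriers N), RRec F D g₀ os R ↔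
      ∃ (θ : Stage13Params F N) (hP : θ.Provisos₁₃Core F N), θ.Admissible F N ∧ D = datumOfRecord₁₃Co F N θ hP ∧ R = rr F θ hP g₀ os)
    (hx : S_R00x (fun F D w => IsRecordOfRecord₁₃CCo F N D w) RRec) (h14 : S_N14 RRec) (h15 : S_N15 RRec) (h16 : S_N16 RRec) (h17 : S_N17 RRec)
    (h18 : S_N18 RRec) (h22 : S_N22 RRec) (hx' : S_N27x (fun F D w => IsRecordOfRecord₁₃CCo F N D w) SRec) (h20 : S_N20 SRec) (h21 : S_N21 SRec)
    (h19₂ : ∀ (F : T4Family) (θ : Stage13Params F N) (hP : θ.Provisos₁₃Core F N) (θ' : Stage13Params F N) (hP' : θ'.Provisos₁₃Core F N),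
      θ.Admissible F N → θ'.Admissible F N → datumOfRecord₁₃Co F N θ' hP' = datumOfRecord₁₃Co F N θ hP → ∀ (g₀ : ℕ → ℝ) (os : List (ULoop F)),
        RatesAt (datumOfRecord₁₃Co F N θ hP) (rr F θ' hP' g₀ os) → letI := (cr F θ hP g₀ os).dec
          ∃ δ : ℕ → ℝ, NE7.Core (cr F θ hP g₀ os).l₀ (cr F θ hP g₀ os).vol (cr F θ hP g₀ os).T (cr F θ hP g₀ os).Bad
            (fun K t τ => (cr F θ hP g₀ os).A K t τ - (cr F θ hP g₀ os).shA K t τ) (fun K t τ => (cr F θ hP g₀ os).B K t τ - (cr F θ hP g₀ os).shB K t τ) δ ∧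
            Summable δ) :
    Spine (N := N) fun F D w => IsRecordOfRecord₁₃CCo F N D w :=
  spine_of_rateStubs_twoKeys (Θ := fun F => Stage13Params F N) (fun θ => θ.Provisos₁₃Core _ N) (fun θ => θ.Admissible _ N) (fun θ h => datumOfRecord₁₃Co _ N θ h) _
    SRec RRec (fun θ h => cr _ θ h) (fun θ h => rr _ θ h) hkeyS hkeyR hx h14 h15 h16 h17 h18 h22 hx' h20 h21 h19₂

end Keyed

/-! ## §3 Honesty at Stage 13: the Stage-11 vacuity mechanism (module XXIII) does NOT transfer -/

section Honesty

/-- The bare coupling of the run `P` of a Stage-13 datum IS `P.g0` (`flow_g_datumOfRecord₁₃Co` ▸ `genSeq_zero`). [bookkeeping] -/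
theorem flow_g_zero_datumOfRecord₁₃Co {F : T4Family} (θ : Stage13Params F N) (h : θ.Provisos₁₃Core F N) (P : B12.RunParams) :
    ((datumOfRecord₁₃Co F N θ h).C P).flow.g 0 = P.g0 := by
  rw [Node00.flow_g_datumOfRecord₁₃Co]
  exact FlowStepRuns.genSeq_zero _ _

/-- **XXIII's ROAD (ii) IS CLOSED AT STAGE 13**: «no level-0 §2 form at positive bare coupling» FAILS at EVERY Stage-13 datum — at the run `⟨0, 0, 1⟩` the bare coupling is
`1 > 0` and the step-0 §2 clause HOLDS (def-T's `Node00.sect2Form_zero_datumOfRecord₁₃Co`); the Stage-11 vacuity certificate does not type-check here. [bookkeeping] -/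
theorem not_levelZeroNegative_datumOfRecord₁₃Co {F : T4Family} (θ : Stage13Params F N) (h : θ.Provisos₁₃Core F N) :
    ¬ ∀ P : B12.RunParams, 0 < ((datumOfRecord₁₃Co F N θ h).C P).flow.g 0 → ¬ ((datumOfRecord₁₃Co F N θ h).C P).Sect2Form 0 := by
  intro hneg
  refine hneg ⟨0, 0, 1⟩ ?_ (Node00.sect2Form_zero_datumOfRecord₁₃Co F N θ h _)
  rw [flow_g_zero_datumOfRecord₁₃Co]
  exact one_pos

end Honesty

/-! ## §4 The re-keyed K3 shapes at generic `N` -/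

section K3Shape

/-- **K3's TEXT RE-KEYED OVER ₁₃CCo (the `(D, w)` form) IS `Spine ₁₃CCo`**: «at every Stage-13 record pair, (B)(D.C) → END(D.C.toB12) → `T4ApexHybrid.HybridNE7Under D END`» ⟺ `Spine ₁₃CCo`
(B5-under-END is itself `(B) → END → ForSmallCouplings …`, definitional: →: apply at the antecedents twice; ←: weaken). [bookkeeping] -/
theorem k3Shape_iff_spine_rec13CCo :
    (∀ (F : T4Family) (D : Datum F N) (w : DagBinding.WorldP), IsRecordOfRecord₁₃CCo F N D w →
      B16.EndStatementBPrinted D.C → DagBinding.EndpointExistence D.C.toB12 →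
        T4ApexHybrid.HybridNE7Under D (DagBinding.EndpointExistence D.C.toB12)) ↔
    Spine (N := N) fun F D w => IsRecordOfRecord₁₃CCo F N D w := by
  refine ⟨fun h F D w hR => ?_, fun h F D w hR _ _ => h F D w hR⟩
  show D.UnderHypotheses _ fun g₀ => T4ApexHybrid.StringwiseHybridNE7 (D.scheme g₀)
  intro hB hEnd
  exact h F D w hR hB hEnd hB hEnd

/-- **FROM `Spine ₁₃CCo` TO THE θ-KEYED GUARDED SENTENCE, ANY GUARD**: B5 at every ₁₃CCo record gives B5 at every admissible Stage-13 datum of record under ANY further guard `G θ` and the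
two displayed antecedents (`spine_rec13CCo_iff_forall_datumOfRecord₁₃Co`; guard, (B), END unused).  At `N = 2`, `G θ := θ.ZtUnity F 2 ∧ θ.SlotsNondegenerate₁₃ F 2`, this is K3
`SpineGivenEndpointR13Co` VERBATIM (module XXXVII-class leaf `spineGivenEndpointR13Co_of_spine_rec13CCo`). [bookkeeping] -/
theorem keyedGuarded₁₃Co_of_spine_rec13CCo (G : ∀ {F : T4Family}, Stage13Params F N → Prop) (h : Spine (N := N) fun F D w => IsRecordOfRecord₁₃CCo F N D w)
    (F : T4Family) (θ : Stage13Params F N) (hP : θ.Provisos₁₃Core F N) (_hG : G θ) (hθ : θ.Admissible F N)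
    (_hB : B16.EndStatementBPrinted (datumOfRecord₁₃Co F N θ hP).C) (_hE : DagBinding.EndpointExistence (datumOfRecord₁₃Co F N θ hP).C.toB12) :
    T4ApexHybrid.HybridNE7Under (datumOfRecord₁₃Co F N θ hP) (DagBinding.EndpointExistence (datumOfRecord₁₃Co F N θ hP).C.toB12) :=
  spine_rec13CCo_iff_forall_datumOfRecord₁₃Co.mp h F θ hP hθ

end K3Shape

/-! ## §5 THE GUARDED BC3 COMPOSER AT THE STAGE-13 KEY (XXIVb at `(Stage13Params, Provisos₁₃Core, Admissible, datumOfRecord₁₃Co)`, guard `G` generic): B5 at every admissible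
Stage-13 datum IN THE GUARDED CLASS from the five keyed faces asked ONLY there -/

section GuardedKeyed

variable (cr : (F : T4Family) → (θ : Stage13Params F N) → θ.Provisos₁₃Core F N → (ℕ → ℝ) → List (ULoop F) → SpineCarriers)
  (rr : (F : T4Family) → (θ : Stage13Params F N) → θ.Provisos₁₃Core F N → (ℕ → ℝ) → List (ULoop F) → RateCarriers N)
  (G : ∀ {F : T4Family}, Stage13Params F N → Prop)

/-- **THE GUARDED θ-KEYED B5 FROM GUARDED KEYED FACES** (XXIVb `forall_guarded_of_keyedFaces` at the Stage-13 key; world-free keyed-datum class, (K1) the identity, (K2)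
`Node00.nonempty_worldP`): if for every Stage-13 θ with provisos satisfying `G θ` AND `θ.Admissible F N`, every `g₀`, `os` — N20 `RelWeightBound` and N21 `ShellWeightBound` at
`cr F θ h g₀ os` · K4's six rates `RatesAt (datumOfRecord₁₃Co F N θ h) (rr F θ h g₀ os)` · the same-tuple N19′ ∃δ-edge · the keyed extraction clause (positivity + E1∕E2 under (B), END, small
tuned couplings) — then «∀ θ h, G θ → θ.Admissible F N → HybridNE7Under (datumOfRecord₁₃Co F N θ h) END».  At `N = 2`, `G := ZtUnity ∧ SlotsNondegenerate₁₃`, this is K3 up to its two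
displayed antecedents (module XXXVII-class leaf `spineGivenEndpointR13Co_of_keyedFaces`).  Every hypothesis 0∕1 today; `cr`, `rr` PARAMETERS. [bookkeeping] -/
theorem keyedGuarded₁₃Co_of_keyedFaces
    (h20 : ∀ (F : T4Family) (θ : Stage13Params F N) (hP : θ.Provisos₁₃Core F N), G θ → θ.Admissible F N → ∀ (g₀ : ℕ → ℝ) (os : List (ULoop F)),
      RelWeightBound (cr F θ hP g₀ os).l₀ (cr F θ hP g₀ os).T (cr F θ hP g₀ os).A (cr F θ hP g₀ os).B (cr F θ hP g₀ os).Bad (cr F θ hP g₀ os).W)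
    (h21 : ∀ (F : T4Family) (θ : Stage13Params F N) (hP : θ.Provisos₁₃Core F N), G θ → θ.Admissible F N → ∀ (g₀ : ℕ → ℝ) (os : List (ULoop F)),
      ShellWeightBound (cr F θ hP g₀ os).l₀ (cr F θ hP g₀ os).T (cr F θ hP g₀ os).A (cr F θ hP g₀ os).B (cr F θ hP g₀ os).shA (cr F θ hP g₀ os).shB
        (cr F θ hP g₀ os).Wsh)
    (hrates : ∀ (F : T4Family) (θ : Stage13Params F N) (hP : θ.Provisos₁₃Core F N), G θ → θ.Admissible F N → ∀ (g₀ : ℕ → ℝ) (os : List (ULoop F)),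
      RatesAt (datumOfRecord₁₃Co F N θ hP) (rr F θ hP g₀ os))
    (h19 : ∀ (F : T4Family) (θ : Stage13Params F N) (hP : θ.Provisos₁₃Core F N), G θ → θ.Admissible F N → ∀ (g₀ : ℕ → ℝ) (os : List (ULoop F)),
      RatesAt (datumOfRecord₁₃Co F N θ hP) (rr F θ hP g₀ os) → letI := (cr F θ hP g₀ os).dec
        ∃ δ : ℕ → ℝ, NE7.Core (cr F θ hP g₀ os).l₀ (cr F θ hP g₀ os).vol (cr F θ hP g₀ os).T (cr F θ hP g₀ os).Bad
          (fun K t τ => (cr F θ hP g₀ os).A K t τ - (cr F θ hP g₀ os).shA K t τ) (fun K t τ => (cr F θ hP g₀ os).B K t τ - (cr F θ hP g₀ os).shB K t τ) δ ∧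
          Summable δ)
    (hx : ∀ (F : T4Family) (θ : Stage13Params F N) (hP : θ.Provisos₁₃Core F N), G θ → θ.Admissible F N →
      B16.EndStatementBPrinted (datumOfRecord₁₃Co F N θ hP).C → DagBinding.EndpointExistence (datumOfRecord₁₃Co F N θ hP).C.toB12 →
        ForSmallCouplings (datumOfRecord₁₃Co F N θ hP) fun g₀ => ∀ os : List (ULoop F),
          0 < (cr F θ hP g₀ os).l₀ ∧ 0 < (cr F θ hP g₀ os).vol ∧
          (∀ (K : ℕ) (t : ℝ), |t| ≤ (cr F θ hP g₀ os).l₀ →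
            T4GenFunBounds.schemeZ ((datumOfRecord₁₃Co F N θ hP).scheme g₀) os ((cr F θ hP g₀ os).K₀ + K) t =
              ∑ τ ∈ (cr F θ hP g₀ os).T K, (cr F θ hP g₀ os).A K t τ) ∧
          (∀ (K : ℕ) (t : ℝ), |t| ≤ (cr F θ hP g₀ os).l₀ →
            T4GenFunBounds.schemeZ ((datumOfRecord₁₃Co F N θ hP).scheme g₀) os ((cr F θ hP g₀ os).K₀ + K + 1) t =
              ∑ τ ∈ (cr F θ hP g₀ os).T K, (cr F θ hP g₀ os).B K t τ))
    (F : T4Family) (θ : Stage13Params F N) (hP : θ.Provisos₁₃Core F N) (hG : G θ) (hθ : θ.Admissible F N) :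
    T4ApexHybrid.HybridNE7Under (datumOfRecord₁₃Co F N θ hP) (DagBinding.EndpointExistence (datumOfRecord₁₃Co F N θ hP).C.toB12) :=
  forall_guarded_of_keyedFaces (Θ := fun F => Stage13Params F N) (fun θ => θ.Provisos₁₃Core _ N) (fun θ => θ.Admissible _ N)
    (fun θ h => datumOfRecord₁₃Co _ N θ h) (fun θ h => cr _ θ h) (fun θ h => rr _ θ h) (fun θ => G θ) h20 h21 hrates h19 hx F θ hP hG hθ

end GuardedKeyed

/-! ## §6 N27 AT node00-def-RR-2's REGIME ∕ CN RECORD CLASSES `Node00.IsRecordOfRecord₁₃CCoOn F N Rg` ∕ `Node00.IsRecordOfRecord₁₃CCoN F N` (`Node00/Record13DatumKeyCo` §§4–7: the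
Stage-13 records whose parameter lies IN the regime `Rg`; guard of record `Node00.unityNondeg₁₃ N`) — the home-free faces (module XXVIII §5's ₁₃ twins); the knits at the
regime-restricted ₁₃ homes are module XXXIXᶜᵒ -/

section RegimeRecord

variable (Rg : (F : T4Family) → Stage13Params F N → Prop)

/-- **B5 AT THE REGIME RECORD CLASS ⟺ THE θ-KEYED SENTENCE GUARDED BY `Rg`** (RR-2 `forall_isRecordOfRecord₁₃CCoOn_iff`, family by family; B5 does not read the world).  At `N = 2`,
`Rg := Node00.unityNondeg₁₃ 2`, the right-hand side is K3 up to its two displayed antecedents (module XXXVII-class leaf `spineGivenEndpointR13Co_iff_spine_rec13CCoN`). [bookkeeping] -/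
theorem spine_rec13CCoOn_iff_forall_guarded :
    Spine (N := N) (fun F D w => Node00.IsRecordOfRecord₁₃CCoOn F N Rg D w) ↔
      ∀ (F : T4Family) (θ : Stage13Params F N) (hP : θ.Provisos₁₃Core F N), Rg F θ → θ.Admissible F N →
        T4ApexHybrid.HybridNE7Under (datumOfRecord₁₃Co F N θ hP) (DagBinding.EndpointExistence (datumOfRecord₁₃Co F N θ hP).C.toB12) :=
  forall_congr' fun F => Node00.forall_isRecordOfRecord₁₃CCoOn_iff F N Rg fun D => T4ApexHybrid.HybridNE7Under D (DagBinding.EndpointExistence D.C.toB12)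

/-- **ANTITONE IN THE CLASS**: B5 at every ₁₃CCo record gives B5 at the regime record class (`IsRecordOfRecord₁₃CCoOn.isRecordOfRecord₁₃CCo`). [bookkeeping] -/
theorem spine_rec13CCoOn_of_spine_rec13CCo (h : Spine (N := N) fun F D w => IsRecordOfRecord₁₃CCo F N D w) :
    Spine (N := N) fun F D w => Node00.IsRecordOfRecord₁₃CCoOn F N Rg D w :=
  spine_antitone (fun _ _ _ hR => Node00.IsRecordOfRecord₁₃CCoOn.isRecordOfRecord₁₃CCo hR) h

/-- **ANTITONE IN THE REGIME**: B5 at the record class of a larger regime gives B5 at that of a smaller one (`IsRecordOfRecord₁₃CCoOn.mono`). [bookkeeping] -/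
theorem spine_rec13CCoOn_anti {Rg Rg' : (F : T4Family) → Stage13Params F N → Prop} (hle : ∀ (F : T4Family) (θ : Stage13Params F N), Rg F θ → Rg' F θ)
    (h : Spine (N := N) fun F D w => Node00.IsRecordOfRecord₁₃CCoOn F N Rg' D w) : Spine (N := N) fun F D w => Node00.IsRecordOfRecord₁₃CCoOn F N Rg D w :=
  spine_antitone (fun _ _ _ hR => Node00.IsRecordOfRecord₁₃CCoOn.mono hle hR) h

/-- At the trivial regime the class IS ₁₃CCo (`isRecordOfRecord₁₃CCoOn_true_iff`): B5 there ⟺ B5 at ₁₃CCo. [bookkeeping] -/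
theorem spine_rec13CCoOn_true_iff :
    (Spine (N := N) fun F D w => Node00.IsRecordOfRecord₁₃CCoOn F N (fun _ _ => True) D w) ↔ Spine (N := N) fun F D w => IsRecordOfRecord₁₃CCo F N D w :=
  ⟨spine_antitone fun _ _ _ hR => Node00.isRecordOfRecord₁₃CCoOn_true_iff.mpr hR, spine_antitone fun _ _ _ hR => Node00.isRecordOfRecord₁₃CCoOn_true_iff.mp hR⟩

/-- **B5 AT THE CN RECORD CLASS ⟺ THE θ-KEYED SENTENCE AT THE GUARD OF RECORD** «`(θ.ZtUnity F N ∧ θ.SlotsNondegenerate₁₃ F N) → θ.Admissible F N →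
HybridNE7Under (datumOfRecord₁₃Co F N θ hP) END`» (`spine_rec13CCoOn_iff_forall_guarded` at `Rg := Node00.unityNondeg₁₃ N`; RR-2 `forall_isRecordOfRecord₁₃CCoN_iff`). [bookkeeping] -/
theorem spine_rec13CCoN_iff_forall_guarded :
    Spine (N := N) (fun F D w => Node00.IsRecordOfRecord₁₃CCoN F N D w) ↔
      ∀ (F : T4Family) (θ : Stage13Params F N) (hP : θ.Provisos₁₃Core F N), (θ.ZtUnity F N ∧ θ.SlotsNondegenerate₁₃ F N) → θ.Admissible F N →
        T4ApexHybrid.HybridNE7Under (datumOfRecord₁₃Co F N θ hP) (DagBinding.EndpointExistence (datumOfRecord₁₃Co F N θ hP).C.toB12) :=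
  spine_rec13CCoOn_iff_forall_guarded (Node00.unityNondeg₁₃ N)

variable (cr : (F : T4Family) → (θ : Stage13Params F N) → θ.Provisos₁₃Core F N → (ℕ → ℝ) → List (ULoop F) → SpineCarriers)
  (rr : (F : T4Family) → (θ : Stage13Params F N) → θ.Provisos₁₃Core F N → (ℕ → ℝ) → List (ULoop F) → RateCarriers N)
  (SRec : SpineRecordPred N)

/-- **N27x AT THE REGIME RECORD CLASS FROM THE GUARDED KEYED EXTRACTION CLAUSE** (XXIV `s_N27x_keyed_of` at the bundled key `Rg ∧ Admissible`; (K1) = RR-2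
`IsRecordOfRecord₁₃CCoOn.exists_regime_tuple`), for ANY spine record `SRec` characterised by the reading `cr` on the regime: if at every admissible θ with provisos IN THE REGIME, under (B)
and END at its datum, for all small tuned `g₀` and every `os`, `cr F θ hP g₀ os` has `0 < l₀`, `0 < vol` and satisfies the E1∕E2 dictionary against the datum's dressed partition functions,
then `S_N27x (IsRecordOfRecord₁₃CCoOn Rg) SRec`.  (At dag-n20-d's regime home `SRec₁₃CoOn cr Rg` the key `hkeyS` is its `sRec₁₃CoOn_iff` re-bracketed — module XXXIX.) [bookkeeping] -/
theorem s_N27x_rec13CCoOn_of_keyed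
    (hkeyS : ∀ (F : T4Family) (D : Datum F N) (g₀ : ℕ → ℝ) (os : List (ULoop F)) (S : SpineCarriers), SRec F D g₀ os S ↔
      ∃ (θ : Stage13Params F N) (h : θ.Provisos₁₃Core F N), (Rg F θ ∧ θ.Admissible F N) ∧ D = datumOfRecord₁₃Co F N θ h ∧ S = cr F θ h g₀ os)
    (hx : ∀ (F : T4Family) (θ : Stage13Params F N) (hP : θ.Provisos₁₃Core F N), Rg F θ → θ.Admissible F N →
      B16.EndStatementBPrinted (datumOfRecord₁₃Co F N θ hP).C → DagBinding.EndpointExistence (datumOfRecord₁₃Co F N θ hP).C.toB12 →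
        ForSmallCouplings (datumOfRecord₁₃Co F N θ hP) fun g₀ => ∀ os : List (ULoop F),
          0 < (cr F θ hP g₀ os).l₀ ∧ 0 < (cr F θ hP g₀ os).vol ∧
          (∀ (K : ℕ) (t : ℝ), |t| ≤ (cr F θ hP g₀ os).l₀ →
            T4GenFunBounds.schemeZ ((datumOfRecord₁₃Co F N θ hP).scheme g₀) os ((cr F θ hP g₀ os).K₀ + K) t =
              ∑ τ ∈ (cr F θ hP g₀ os).T K, (cr F θ hP g₀ os).A K t τ) ∧
          (∀ (K : ℕ) (t : ℝ), |t| ≤ (cr F θ hP g₀ os).l₀ →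
            T4GenFunBounds.schemeZ ((datumOfRecord₁₃Co F N θ hP).scheme g₀) os ((cr F θ hP g₀ os).K₀ + K + 1) t =
              ∑ τ ∈ (cr F θ hP g₀ os).T K, (cr F θ hP g₀ os).B K t τ)) :
    S_N27x (fun F D w => Node00.IsRecordOfRecord₁₃CCoOn F N Rg D w) SRec :=
  s_N27x_keyed_of (Θ := fun F => Stage13Params F N) (fun θ => θ.Provisos₁₃Core _ N) (fun θ => Rg _ θ ∧ θ.Admissible _ N) (fun θ h => datumOfRecord₁₃Co _ N θ h) _
    SRec (fun θ h => cr _ θ h)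
    (fun _ _ _ hR => by
      obtain ⟨θ, hP, hRg, hθ, hD⟩ := Node00.IsRecordOfRecord₁₃CCoOn.exists_regime_tuple hR
      exact ⟨θ, hP, ⟨hRg, hθ⟩, hD⟩)
    hkeyS fun F θ hP hA => hx F θ hP hA.1 hA.2

/-- **N27 = B5 AT THE REGIME RECORD CLASS FROM THE GUARDED KEYED FACES** (§5 `keyedGuarded₁₃Co_of_keyedFaces` at `G := Rg F` ∘ `spine_rec13CCoOn_iff_forall_guarded`): the five keyed
faces asked ONLY of admissible tuples with provisos IN THE REGIME ⇒ `Spine (IsRecordOfRecord₁₃CCoOn Rg)`.  At `N = 2`, `Rg := Node00.unityNondeg₁₃ 2`, the conclusion is `Spine ₁₃CCoN` ⟺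
K3 (module XXXVII-class leaf).  Every hypothesis 0∕1 today; `cr`, `rr` PARAMETERS. [bookkeeping] -/
theorem spine_rec13CCoOn_of_keyedFaces
    (h20 : ∀ (F : T4Family) (θ : Stage13Params F N) (hP : θ.Provisos₁₃Core F N), Rg F θ → θ.Admissible F N → ∀ (g₀ : ℕ → ℝ) (os : List (ULoop F)),
      RelWeightBound (cr F θ hP g₀ os).l₀ (cr F θ hP g₀ os).T (cr F θ hP g₀ os).A (cr F θ hP g₀ os).B (cr F θ hP g₀ os).Bad (cr F θ hP g₀ os).W)
    (h21 : ∀ (F : T4Family) (θ : Stage13Params F N) (hP : θ.Provisos₁₃Core F N), Rg F θ → θ.Admissible F N → ∀ (g₀ : ℕ → ℝ) (os : List (ULoop F)),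
      ShellWeightBound (cr F θ hP g₀ os).l₀ (cr F θ hP g₀ os).T (cr F θ hP g₀ os).A (cr F θ hP g₀ os).B (cr F θ hP g₀ os).shA (cr F θ hP g₀ os).shB
        (cr F θ hP g₀ os).Wsh)
    (hrates : ∀ (F : T4Family) (θ : Stage13Params F N) (hP : θ.Provisos₁₃Core F N), Rg F θ → θ.Admissible F N → ∀ (g₀ : ℕ → ℝ) (os : List (ULoop F)),
      RatesAt (datumOfRecord₁₃Co F N θ hP) (rr F θ hP g₀ os))
    (h19 : ∀ (F : T4Family) (θ : Stage13Params F N) (hP : θ.Provisos₁₃Core F N), Rg F θ → θ.Admissible F N → ∀ (g₀ : ℕ → ℝ) (os : List (ULoop F)),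
      RatesAt (datumOfRecord₁₃Co F N θ hP) (rr F θ hP g₀ os) → letI := (cr F θ hP g₀ os).dec
        ∃ δ : ℕ → ℝ, NE7.Core (cr F θ hP g₀ os).l₀ (cr F θ hP g₀ os).vol (cr F θ hP g₀ os).T (cr F θ hP g₀ os).Bad
          (fun K t τ => (cr F θ hP g₀ os).A K t τ - (cr F θ hP g₀ os).shA K t τ) (fun K t τ => (cr F θ hP g₀ os).B K t τ - (cr F θ hP g₀ os).shB K t τ) δ ∧
          Summable δ)
    (hx : ∀ (F : T4Family) (θ : Stage13Params F N) (hP : θ.Provisos₁₃Core F N), Rg F θ → θ.Admissible F N →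
      B16.EndStatementBPrinted (datumOfRecord₁₃Co F N θ hP).C → DagBinding.EndpointExistence (datumOfRecord₁₃Co F N θ hP).C.toB12 →
        ForSmallCouplings (datumOfRecord₁₃Co F N θ hP) fun g₀ => ∀ os : List (ULoop F),
          0 < (cr F θ hP g₀ os).l₀ ∧ 0 < (cr F θ hP g₀ os).vol ∧
          (∀ (K : ℕ) (t : ℝ), |t| ≤ (cr F θ hP g₀ os).l₀ →
            T4GenFunBounds.schemeZ ((datumOfRecord₁₃Co F N θ hP).scheme g₀) os ((cr F θ hP g₀ os).K₀ + K) t =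
              ∑ τ ∈ (cr F θ hP g₀ os).T K, (cr F θ hP g₀ os).A K t τ) ∧
          (∀ (K : ℕ) (t : ℝ), |t| ≤ (cr F θ hP g₀ os).l₀ →
            T4GenFunBounds.schemeZ ((datumOfRecord₁₃Co F N θ hP).scheme g₀) os ((cr F θ hP g₀ os).K₀ + K + 1) t =
              ∑ τ ∈ (cr F θ hP g₀ os).T K, (cr F θ hP g₀ os).B K t τ)) :
    Spine (N := N) fun F D w => Node00.IsRecordOfRecord₁₃CCoOn F N Rg D w :=
  (spine_rec13CCoOn_iff_forall_guarded Rg).mpr (keyedGuarded₁₃Co_of_keyedFaces cr rr (fun θ => Rg _ θ) h20 h21 hrates h19 hx)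

end RegimeRecord

end Summit.QuantumFields.YangMills.Theorems.BalabanUVNodesN27SpineRecord
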